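import Summits.QuantumFields.YangMills.Theorems.BalabanUVNodesN07PointFeasibilityOneLevelSymbolBridge
import Summits.QuantumFields.YangMills.Theorems.BalabanUVNodesN07AliasSumMarginSigned
import HarnessLib

/-!
# DAG node N07 [B11], road R0′ — the ONE-LEVEL MARGIN IN x-SPACE WITH THE EXPLICIT CONSTANT `π^{−d}`: for every odd block side `n ≥ 3`,
# every dimension `d`, every torus and every block function `β`, `π^{−d}·‖Δ⁻¹Q′ᴴβ‖² ≤ Re Σ_y conj β(y)·(Δ⁻²Q′ᴴβ)(ny + c₀)`

Cell `pub-ymgap` (HUMAN RULINGS D-0062 ∕ D-0149 ∕ D-0154), width seat `pub-ymgap-dag-n07-w5` g2, 2026-08-28.  `--kind proof --supports <K1 key>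
--as helper` (count-neutral; INTENT-5 cell bus 11:19Z).  The COMPOSITION announced on the bus by both desks: dag-n07-w7 g4's display margin
`…N07AliasSumMarginSigned.displayMargin_hDisp` (p627978; the (L1) margin «K₀(θ) ≤ π^{|J|}·K(θ)» of `…N07AliasSumMargin` in the raw alias-sum
shape) inhabits the hypothesis `hDisp` of this base's `…OneLevelSymbolBridge.norm_sq_lapInv_le_centreForm_of_display` (p626779, ∘ p625080's
transfer) at the per-coordinate constant `c₁ = π⁻¹`.  Road item (★)₁ of `pub-ymgap-dag-n07-w5/LOCATED-PD-LOCALIZATION-ROAD.md` is thereby a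
kernel theorem ON THE TORUS with `c = π^{−d}`, uniform in the torus size — what road item (L4) (IMS assembly) consumes.

THE PRINT.  [B5] = T. Bałaban, CMP **95** (1984) 17–40 `[Balaban1984PropagatorsI]`, Sect. C p. 22 («Q′_kΔ⁻²Q′*_k», typed `B5Substitution125.Mop`),
(1.29)–(1.33) p. 23; [B6] = CMP **96** (1984) 223–250 `[Balaban1984PropagatorsII]`, (2.22) p. 226 (block means); [I] = CMP **109** (1987) 249–301
`[Balaban1987RG1]`, (0.4) p. 253 (centres of blocks; odd `L`).  Context only.

HONEST FRAMING (binding).  Count-neutral helper; ONE composition line per theorem; the constant `π^{−d}` is dag-n07-w7's, the transfer is p625080 ∕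
p626779; numerically the true constant is `1` (proved for `n = 3` in `…AliasSumMarginSharpSmallL`, OPEN for `n ≥ 7`); one averaging level; asserts
NOTHING of [B11]∕[B6]∕[3]; `(P)_D` ∕ (L2)–(L4) OPEN; nothing consumed under road (a); `hker` ∕ stub 1 ∕ K0⁷ ∕ K1⁹ NOT closed; N07 NOT discharged;
counts unmoved; no summit statement is proved by this seat — R4 closes the conditional finite-𝕋⁴ rung `BalabanLadder.UV` only; nothing continuum ∕
ℝ⁴ ∕ OS ∕ mass gap ∕ Clay.  No `sorry`, no `def`, no `instance`, no `notation`.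
-/

noncomputable section

open scoped BigOperators Matrix ComplexConjugate
open Finset

namespace Summit.QuantumFields.YangMills.BalabanUVNodes.N07PointFeasibilityOneLevel

open Literature.MathematicalPhysics.QuantumFieldTheory.Balaban1983to89
open B5Prop11Plancherel (Tor fine)
open B5Block118 (bpt QsOp)
open B5LaplaceInverse (LapSinv)
open B5Substitution125 (Mop)
open Summit.QuantumFields.YangMills.Theorems.N07AliasSumMargin (displayMargin_hDisp)

variable {d : ℕ} (n : ℕ) [NeZero n] (M : Fin d → ℕ) [hM : ∀ μ, NeZero (M μ)]

/-- ★★★ **THE ONE-LEVEL MARGIN IN x-SPACE, CONSTANT `(π⁻¹)^d`**: for odd `n = 2c₀+1 ≥ 3`, on the torus `Tor (fine n M)` of any dimension `d` and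
any coarse size, for EVERY block function `β`:
`(π⁻¹)^d · Σ_x |(Δ⁻¹Q′ᴴβ)(x)|² ≤ Re Σ_y conj β(y)·(Δ⁻²Q′ᴴβ)(ny + c₀)` — dag-n07-w7's `displayMargin_hDisp` ∘ this base's
`norm_sq_lapInv_le_centreForm_of_display`. [cite: Balaban1984PropagatorsI, Sect. C p.22, (1.30)–(1.33) p.23; Balaban1987RG1, (0.4) p.253] -/
theorem norm_sq_lapInv_le_centreForm_pi (hn : Odd n) (h3 : 3 ≤ n) (c₀ : Fin d → Fin n) (hc₀ : ∀ ν, 2 * (c₀ ν : ℕ) + 1 = n)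
    (β : Tor M → ℂ) :
    Real.pi⁻¹ ^ d * ∑ x, ‖(LapSinv (fine n M) (n : ℂ) *ᵥ ((QsOp n M)ᴴ *ᵥ β)) x‖ ^ 2 ≤
      (star β ⬝ᵥ (fun y => (LapSinv (fine n M) (n : ℂ) *ᵥ (LapSinv (fine n M) (n : ℂ) *ᵥ ((QsOp n M)ᴴ *ᵥ β)))
        (bpt n M y c₀))).re :=
  norm_sq_lapInv_le_centreForm_of_display n M c₀ hc₀ (inv_nonneg.mpr Real.pi_pos.le)
    (inv_le_one_of_one_le₀ (by linarith [Real.pi_gt_three])) (displayMargin_hDisp hn h3) β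

/-- ★★★ the same with the matched form written as `⟨β, Q′Δ⁻²Q′ᴴβ⟩` (`B5Substitution125.Mop`) and the constant as `(π^d)⁻¹`:
`(π^d)⁻¹ · Re⟨β, Q′Δ⁻²Q′ᴴβ⟩ ≤ Re Σ_y conj β(y)·(Δ⁻²Q′ᴴβ)(ny + c₀)`. [cite: Balaban1984PropagatorsI, Sect. C p.22; Balaban1984PropagatorsII, (2.22) p.226] -/
theorem matchedForm_le_centreForm_pi (hn : Odd n) (h3 : 3 ≤ n) (c₀ : Fin d → Fin n) (hc₀ : ∀ ν, 2 * (c₀ ν : ℕ) + 1 = n)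
    (β : Tor M → ℂ) :
    (Real.pi ^ d)⁻¹ * (star β ⬝ᵥ (Mop n M (n : ℂ) *ᵥ β)).re ≤
      (star β ⬝ᵥ (fun y => (LapSinv (fine n M) (n : ℂ) *ᵥ (LapSinv (fine n M) (n : ℂ) *ᵥ ((QsOp n M)ᴴ *ᵥ β)))
        (bpt n M y c₀))).re := by
  rw [matchedForm_eq_norm_sq, Complex.ofReal_re, ← inv_pow]
  exact norm_sq_lapInv_le_centreForm_pi n M hn h3 c₀ hc₀ β

end Summit.QuantumFields.YangMills.BalabanUVNodes.N07PointFeasibilityOneLevel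

end
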